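import Mathlib
import HarnessLib
import Summits.NavierStokesRegularity.NavierStokesRegularity.Theses.EulerZoomLiouville

/-!
# Route `EulerZoomLiouville` (route №10 of cell ns-regularity-ideate §B, rung LADDER-NS N0) — the ASSEMBLY

Seat ns-typeII-p3 (prover, D-0081 §B first rungs). The route was born 2026-08-26T22:34:43Z
(`route-NavierStokesRegularity-EulerZoomLiouville`, tribunal r1 PASSED, tier B) with items
E = `PowerGaugeEulerLiouville` (stmt-NavierStokesRegularity-19832, deciding crux),
R₁ = `TypeIOrPowerZoomable` (stmt-19833, declared residual), R₂ = `TypeIliouvilleL` (stmt-10661, KNSS (L), declared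
residual), Z = `SereginZoomReduction` (stmt-19834, printed support) and this `Assembly` (stmt-NavierStokesRegularity-19835),
whose type is EXACTLY the type of the gate-certified deciding theorem `closes` of the Theses file. This file records the
assembly BY NAME against the born Theses decl (closing item stmt-NavierStokesRegularity-19835); it carries no mathematics
of its own — the logic (Type I branch killed by (L) through `typeILiouville_typeIliouvilleLKillsTypeI_proof`, power-zoomable
branch killed by Z + E) lives in `closes`.

WHAT THIS IS NOT: not a claim about Navier–Stokes regularity (Clay A) and not progress on E, R₁, R₂ or Z — all four stay
OPEN items; this is the bookkeeping conjunct «the four conjuncts imply the summit statement».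
-/

noncomputable section

-- the summit and its single sub-problem share the name (CONVENTIONS §1), as in every Theorems file
set_option linter.dupNamespace false

namespace Summit.NavierStokesRegularity.NavierStokesRegularity.Theorems.EulerZoomLiouvilleAssembly

open Summit.NavierStokesRegularity.NavierStokesRegularity.Theses.EulerZoomLiouville

/-- **The route's `Assembly` (item stmt-NavierStokesRegularity-19835)**:
`PowerGaugeEulerLiouville → SereginZoomReduction → TypeIOrPowerZoomable → TypeIliouvilleL → NavierStokesRegularity`,
by the gate-certified deciding theorem `closes`. -/
theorem assembly_proof :
    Summit.NavierStokesRegularity.NavierStokesRegularity.Theses.EulerZoomLiouville.Assembly :=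
  fun hEL hZoom hCov hL => closes hEL hZoom hCov hL

end Summit.NavierStokesRegularity.NavierStokesRegularity.Theorems.EulerZoomLiouvilleAssembly

end
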